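import Summits.KontsevichZagierPeriods.KontsevichZagierPeriods.Theorems.FurushoPentagonPentagonInKZCornerCubes
import Summits.KontsevichZagierPeriods.KontsevichZagierPeriods.Theorems.FurushoPentagonPentagonInKZCornerBlocks
import Literature.NumberTheory.Transcendental.Associators
import Summits.KontsevichZagierPeriods.KontsevichZagierPeriods.Theorems.FurushoPentagonPentagonInKZCornerEngineEulerAux
import Summits.KontsevichZagierPeriods.KontsevichZagierPeriods.Theorems.FurushoPentagonPentagonInKZCornerEngineExistQ

/-!
# `PentagonInKZ`, line `edge-normal-newton-leibniz`: corner engine — Step A.1 (peel and split)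

Over the abstract signature of the corner engine (see `…CornerEngineMirror.lean`): the pointwise peeling identities (★A)
of the first edge transport at the outermost cubical variable (`peel_op`, from the peeling
identity of the bundle; `starA`, with the centrality of the regularised residue against the
other edge transport; `starA_zero` at height `0`), and Step A.1 of the engine (`stepA_split`):
after moving the outermost variable to the parameter block, the class of `σ[A(Ξ,Η) − A(Ξ,0)]` is
the sum over letters of an instance of uniform nullity one degree down and of a height difference.

References: K. Ihara, M. Kaneko, D. Zagier, Compos. Math. 142 (2006), Cor. 5; V. G. Drinfeld,
Leningrad Math. J. 2 (1991), §2.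
-/

noncomputable section

open Set MeasureTheory
open Literature.NumberTheory.Transcendental
open Literature.ModelTheory.ExponentialFields (IsSemialgebraic)

namespace Summit.KontsevichZagierPeriods.FurushoPentagon.PentagonInKZ

section AbstractEngine

variable {m N : ℕ} {ℓ ℓ' : Fin (m + 2)} {α β : ℚ}
  {Zq : Fin (m + 2) → (DrinfeldKohnoTrunc ℚ (Fin 4) N)} {wZ : ∀ {n : ℕ}, (Fin n → Fin (m + 2)) → (DrinfeldKohnoTrunc ℚ (Fin 4) N)}
  {fd gd dd : Fin (m + 2) → ℝ → ℝ → ℝ}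
  {Ht Vt dHt dVt : ∀ {n : ℕ}, (Fin n → Fin (m + 2)) → (Fin n → ℝ) → ℝ → ℝ → ℝ}
  {op opV : Fin (m + 2) → (DrinfeldKohnoTrunc ℚ (Fin 4) N) →ₗ[ℚ] (DrinfeldKohnoTrunc ℚ (Fin 4) N)}
  {Af Bf dAf dBf F : ((DrinfeldKohnoTrunc ℚ (Fin 4) N) →ₗ[ℚ] ℚ) → ∀ {k l : ℕ}, (Fin k → ℝ) → (Fin l → ℝ) → ℝ → ℝ → ℝ}
  {Xb : ∀ k l e : ℕ, (Fin (k + l + e) → ℝ) → Fin k → ℝ}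
  {Yb : ∀ k l e : ℕ, (Fin (k + l + e) → ℝ) → Fin l → ℝ}
  {Θb : ∀ k l e : ℕ, (Fin (k + l + e) → ℝ) → Fin e → ℝ}

variable (H :
    (∀ {n : ℕ} (U : Fin n → Fin (m + 2)), wZ U = ((List.ofFn U).map Zq).prod) ∧
    (∀ (a : Fin (m + 2)) (X : (DrinfeldKohnoTrunc ℚ (Fin 4) N)), op a X = if a = ℓ then Zq ℓ * X - X * Zq ℓ else Zq a * X) ∧
    (∀ (b : Fin (m + 2)) (X : (DrinfeldKohnoTrunc ℚ (Fin 4) N)), opV b X = if b = ℓ' then Zq ℓ' * X - X * Zq ℓ' else Zq b * X) ∧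
    (∀ (μ : (DrinfeldKohnoTrunc ℚ (Fin 4) N) →ₗ[ℚ] ℚ) {k l : ℕ} (x : Fin k → ℝ) (y : Fin l → ℝ) (ξ η : ℝ), Af μ x y ξ η = ∑ U : Fin k → Fin (m + 2), ∑ V : Fin l → Fin (m + 2), (μ (wZ U * wZ V) : ℝ) * (Ht U x ξ η * Vt V y 0 η)) ∧
    (∀ (μ : (DrinfeldKohnoTrunc ℚ (Fin 4) N) →ₗ[ℚ] ℚ) {k l : ℕ} (x : Fin k → ℝ) (y : Fin l → ℝ) (ξ η : ℝ), Bf μ x y ξ η = ∑ U : Fin k → Fin (m + 2), ∑ V : Fin l → Fin (m + 2), (μ (wZ V * wZ U) : ℝ) * (Vt V y ξ η * Ht U x ξ 0)) ∧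
    (∀ (μ : (DrinfeldKohnoTrunc ℚ (Fin 4) N) →ₗ[ℚ] ℚ) {k l : ℕ} (x : Fin k → ℝ) (y : Fin l → ℝ) (ξ η : ℝ), dAf μ x y ξ η = ∑ U : Fin k → Fin (m + 2), ∑ V : Fin l → Fin (m + 2), (μ (wZ U * wZ V) : ℝ) * (dHt U x ξ η * Vt V y 0 η)) ∧
    (∀ (μ : (DrinfeldKohnoTrunc ℚ (Fin 4) N) →ₗ[ℚ] ℚ) {k l : ℕ} (x : Fin k → ℝ) (y : Fin l → ℝ) (ξ η : ℝ), dBf μ x y ξ η = ∑ U : Fin k → Fin (m + 2), ∑ V : Fin l → Fin (m + 2), (μ (wZ V * wZ U) : ℝ) * (dVt V y ξ η * Ht U x ξ 0)) ∧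
    (∀ (μ : (DrinfeldKohnoTrunc ℚ (Fin 4) N) →ₗ[ℚ] ℚ) {k l : ℕ} (x : Fin k → ℝ) (y : Fin l → ℝ) (ξ η : ℝ), F μ x y ξ η = Af μ x y ξ η - Bf μ x y ξ η) ∧
    (∀ (k l e : ℕ) (z : Fin (k + l + e) → ℝ), Xb k l e z = fun i => z (Fin.castAdd e (Fin.castAdd l i))) ∧
    (∀ (k l e : ℕ) (z : Fin (k + l + e) → ℝ), Yb k l e z = fun j => z (Fin.castAdd e (Fin.natAdd k j))) ∧
    (∀ (k l e : ℕ) (z : Fin (k + l + e) → ℝ), Θb k l e z = fun s => z (Fin.natAdd (k + l) s)) ∧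
    (∀ (U : Fin 0 → Fin (m + 2)) (x : Fin 0 → ℝ) (ξ η : ℝ), Ht U x ξ η = 1) ∧
    (∀ (V : Fin 0 → Fin (m + 2)) (y : Fin 0 → ℝ) (ξ η : ℝ), Vt V y ξ η = 1) ∧
    (∀ (U : Fin 0 → Fin (m + 2)) (x : Fin 0 → ℝ) (ξ η : ℝ), dHt U x ξ η = 0) ∧
    (∀ (V : Fin 0 → Fin (m + 2)) (y : Fin 0 → ℝ) (ξ η : ℝ), dVt V y ξ η = 0) ∧
    (∀ {k : ℕ} (U : Fin (k + 1) → Fin (m + 2)) (x : Fin (k + 1) → ℝ) (η : ℝ), Ht U x 0 η = 0) ∧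
    (∀ {l : ℕ} (V : Fin (l + 1) → Fin (m + 2)) (y : Fin (l + 1) → ℝ) (ξ : ℝ), Vt V y ξ 0 = 0) ∧
    (∀ t y : ℝ, fd ℓ t y = 1 / t) ∧
    (∀ x s : ℝ, gd ℓ' x s = 1 / s) ∧
    (∀ x y : ℝ, dd ℓ x y = 0) ∧
    (∀ x y : ℝ, dd ℓ' x y = 0) ∧
    (∀ (μ : (DrinfeldKohnoTrunc ℚ (Fin 4) N) →ₗ[ℚ] ℚ) {k : ℕ} (x₀ : ℝ) (x' : Fin k → ℝ) (ξ η : ℝ), ∑ U : Fin (k + 1) → Fin (m + 2), (μ (wZ U) : ℝ) * Ht U (Fin.cons x₀ x') ξ η = (∑ a : Fin (m + 2), (if a = ℓ then 1 / x₀ else ξ * fd a (ξ * x₀) η) * ∑ U' : Fin k → Fin (m + 2), (μ (Zq a * wZ U') : ℝ) * Ht U' x' (ξ * x₀) η) - (1 / x₀) * ∑ U' : Fin k → Fin (m + 2), (μ (wZ U' * Zq ℓ) : ℝ) * Ht U' x' (ξ * x₀) η) ∧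
    (∀ (μ : (DrinfeldKohnoTrunc ℚ (Fin 4) N) →ₗ[ℚ] ℚ) {l : ℕ} (y₀ : ℝ) (y' : Fin l → ℝ) (ξ η : ℝ), ∑ V : Fin (l + 1) → Fin (m + 2), (μ (wZ V) : ℝ) * Vt V (Fin.cons y₀ y') ξ η = (∑ b : Fin (m + 2), (if b = ℓ' then 1 / y₀ else η * gd b ξ (η * y₀)) * ∑ V' : Fin l → Fin (m + 2), (μ (Zq b * wZ V') : ℝ) * Vt V' y' ξ (η * y₀)) - (1 / y₀) * ∑ V' : Fin l → Fin (m + 2), (μ (wZ V' * Zq ℓ') : ℝ) * Vt V' y' ξ (η * y₀)) ∧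
    (∀ (μ : (DrinfeldKohnoTrunc ℚ (Fin 4) N) →ₗ[ℚ] ℚ) {l : ℕ} (P Q : (DrinfeldKohnoTrunc ℚ (Fin 4) N)) (y : Fin l → ℝ) (η : ℝ), (∀ i, 0 < y i ∧ y i < 1) → 0 < η → η ≤ (β : ℝ) → ∑ V : Fin l → Fin (m + 2), (μ (P * (Zq ℓ * wZ V - wZ V * Zq ℓ) * Q) : ℝ) * Vt V y 0 η = 0) ∧
    (∀ (μ : (DrinfeldKohnoTrunc ℚ (Fin 4) N) →ₗ[ℚ] ℚ) {k : ℕ} (P Q : (DrinfeldKohnoTrunc ℚ (Fin 4) N)) (x : Fin k → ℝ) (ξ : ℝ), (∀ i, 0 < x i ∧ x i < 1) → 0 < ξ → ξ ≤ (α : ℝ) → ∑ U : Fin k → Fin (m + 2), (μ (P * (Zq ℓ' * wZ U - wZ U * Zq ℓ') * Q) : ℝ) * Ht U x ξ 0 = 0) ∧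
    (∀ (μ : (DrinfeldKohnoTrunc ℚ (Fin 4) N) →ₗ[ℚ] ℚ) (P Q : (DrinfeldKohnoTrunc ℚ (Fin 4) N)), μ (P * (Zq ℓ * Zq ℓ' - Zq ℓ' * Zq ℓ) * Q) = 0) ∧
    (∀ (μ : (DrinfeldKohnoTrunc ℚ (Fin 4) N) →ₗ[ℚ] ℚ) (P Q : (DrinfeldKohnoTrunc ℚ (Fin 4) N)) (x y : ℝ), 0 < x → x < (α : ℝ) → 0 < y → y < (β : ℝ) → ∑ a : Fin (m + 2), ∑ b : Fin (m + 2), (fd a x y * gd b x y) * (μ (P * (Zq a * Zq b - Zq b * Zq a) * Q) : ℝ) = 0) ∧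
    (∀ (μ : (DrinfeldKohnoTrunc ℚ (Fin 4) N) →ₗ[ℚ] ℚ) (P Q : (DrinfeldKohnoTrunc ℚ (Fin 4) N)) (s : ℝ), 0 < s → s < (β : ℝ) → ∑ b : Fin (m + 2), gd b 0 s * (μ (P * (Zq ℓ * Zq b - Zq b * Zq ℓ) * Q) : ℝ) = 0) ∧
    (∀ (μ : (DrinfeldKohnoTrunc ℚ (Fin 4) N) →ₗ[ℚ] ℚ) (P Q : (DrinfeldKohnoTrunc ℚ (Fin 4) N)) (t : ℝ), 0 < t → t < (α : ℝ) → ∑ a : Fin (m + 2), fd a t 0 * (μ (P * (Zq ℓ' * Zq a - Zq a * Zq ℓ') * Q) : ℝ) = 0) ∧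
    (∀ (a : Fin (m + 2)) (ξ η : ℝ), 0 ≤ ξ → ξ ≤ (α : ℝ) → 0 ≤ η → η ≤ (β : ℝ) → HasDerivAt (fun y => fd a ξ y) (dd a ξ η) η) ∧
    (∀ (b : Fin (m + 2)) (ξ η : ℝ), 0 ≤ ξ → ξ ≤ (α : ℝ) → 0 ≤ η → η ≤ (β : ℝ) → HasDerivAt (fun x => gd b x η) (dd b ξ η) ξ) ∧
    (∀ {k : ℕ} (U : Fin k → Fin (m + 2)) (x : Fin k → ℝ) (ξ η : ℝ), (∀ i, 0 ≤ x i ∧ x i ≤ 1) → 0 ≤ ξ → ξ ≤ (α : ℝ) → 0 ≤ η → η ≤ (β : ℝ) → HasDerivAt (fun t => Ht U x t η) (dHt U x ξ η) ξ) ∧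
    (∀ {l : ℕ} (V : Fin l → Fin (m + 2)) (y : Fin l → ℝ) (ξ η : ℝ), (∀ i, 0 ≤ y i ∧ y i ≤ 1) → 0 ≤ ξ → ξ ≤ (α : ℝ) → 0 ≤ η → η ≤ (β : ℝ) → HasDerivAt (fun s => Vt V y ξ s) (dVt V y ξ η) η) ∧
    (∀ {k : ℕ} (U : Fin (k + 1) → Fin (m + 2)) (x₀ : ℝ) (x' : Fin k → ℝ) (ξ η : ℝ), 0 < x₀ → x₀ < 1 → (∀ i, 0 ≤ x' i ∧ x' i ≤ 1) → 0 ≤ ξ → ξ ≤ (α : ℝ) → 0 ≤ η → η ≤ (β : ℝ) → HasDerivAt (fun t => t * Ht U (Fin.cons t x') ξ η) (ξ * dHt U (Fin.cons x₀ x') ξ η) x₀) ∧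
    (∀ {l : ℕ} (V : Fin (l + 1) → Fin (m + 2)) (y₀ : ℝ) (y' : Fin l → ℝ) (ξ η : ℝ), 0 < y₀ → y₀ < 1 → (∀ i, 0 ≤ y' i ∧ y' i ≤ 1) → 0 ≤ ξ → ξ ≤ (α : ℝ) → 0 ≤ η → η ≤ (β : ℝ) → HasDerivAt (fun t => t * Vt V (Fin.cons t y') ξ η) (η * dVt V (Fin.cons y₀ y') ξ η) y₀) ∧
    (∀ {k : ℕ} (U : Fin (k + 1) → Fin (m + 2)) (x' : Fin k → ℝ) (ξ η : ℝ), (∀ i, 0 ≤ x' i ∧ x' i ≤ 1) → 0 ≤ ξ → ξ ≤ (α : ℝ) → 0 ≤ η → η ≤ (β : ℝ) → ContinuousOn (fun t => t * Ht U (Fin.cons t x') ξ η) (Set.Icc 0 1)) ∧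
    (∀ {l : ℕ} (V : Fin (l + 1) → Fin (m + 2)) (y' : Fin l → ℝ) (ξ η : ℝ), (∀ i, 0 ≤ y' i ∧ y' i ≤ 1) → 0 ≤ ξ → ξ ≤ (α : ℝ) → 0 ≤ η → η ≤ (β : ℝ) → ContinuousOn (fun t => t * Vt V (Fin.cons t y') ξ η) (Set.Icc 0 1)) ∧
    (∀ {d : ℕ} {W : Set (Fin d → ℝ)}, IsSemialgebraic ℚ W → ∀ (a : Fin (m + 2)) {T Y : (Fin d → ℝ) → ℝ}, IsSemialgebraicFunOn ℚ W T → IsSemialgebraicFunOn ℚ W Y → IsSemialgebraicFunOn ℚ W fun z => fd a (T z) (Y z)) ∧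
    (∀ {d : ℕ} {W : Set (Fin d → ℝ)}, IsSemialgebraic ℚ W → ∀ (b : Fin (m + 2)) {T Y : (Fin d → ℝ) → ℝ}, IsSemialgebraicFunOn ℚ W T → IsSemialgebraicFunOn ℚ W Y → IsSemialgebraicFunOn ℚ W fun z => gd b (T z) (Y z)) ∧
    (∀ {d : ℕ} {W : Set (Fin d → ℝ)}, IsSemialgebraic ℚ W → ∀ (a : Fin (m + 2)) {T Y : (Fin d → ℝ) → ℝ}, IsSemialgebraicFunOn ℚ W T → IsSemialgebraicFunOn ℚ W Y → IsSemialgebraicFunOn ℚ W fun z => dd a (T z) (Y z)) ∧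
    (∀ {d : ℕ} {W : Set (Fin d → ℝ)}, IsSemialgebraic ℚ W → ∀ {n : ℕ} (U : Fin n → Fin (m + 2)) {X : (Fin d → ℝ) → Fin n → ℝ} {P Q : (Fin d → ℝ) → ℝ}, (∀ i, IsSemialgebraicFunOn ℚ W fun z => X z i) → IsSemialgebraicFunOn ℚ W P → IsSemialgebraicFunOn ℚ W Q → IsSemialgebraicFunOn ℚ W fun z => Ht U (X z) (P z) (Q z)) ∧
    (∀ {d : ℕ} {W : Set (Fin d → ℝ)}, IsSemialgebraic ℚ W → ∀ {n : ℕ} (V : Fin n → Fin (m + 2)) {Y : (Fin d → ℝ) → Fin n → ℝ} {P Q : (Fin d → ℝ) → ℝ}, (∀ i, IsSemialgebraicFunOn ℚ W fun z => Y z i) → IsSemialgebraicFunOn ℚ W P → IsSemialgebraicFunOn ℚ W Q → IsSemialgebraicFunOn ℚ W fun z => Vt V (Y z) (P z) (Q z)) ∧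
    (∀ {d : ℕ} {W : Set (Fin d → ℝ)}, IsSemialgebraic ℚ W → ∀ {n : ℕ} (U : Fin n → Fin (m + 2)) {X : (Fin d → ℝ) → Fin n → ℝ} {P Q : (Fin d → ℝ) → ℝ}, (∀ i, IsSemialgebraicFunOn ℚ W fun z => X z i) → IsSemialgebraicFunOn ℚ W P → IsSemialgebraicFunOn ℚ W Q → IsSemialgebraicFunOn ℚ W fun z => dHt U (X z) (P z) (Q z)) ∧
    (∀ {d : ℕ} {W : Set (Fin d → ℝ)}, IsSemialgebraic ℚ W → ∀ {n : ℕ} (V : Fin n → Fin (m + 2)) {Y : (Fin d → ℝ) → Fin n → ℝ} {P Q : (Fin d → ℝ) → ℝ}, (∀ i, IsSemialgebraicFunOn ℚ W fun z => Y z i) → IsSemialgebraicFunOn ℚ W P → IsSemialgebraicFunOn ℚ W Q → IsSemialgebraicFunOn ℚ W fun z => dVt V (Y z) (P z) (Q z)) ∧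
    (∃ C : ℝ, ∀ (a : Fin (m + 2)) (ξ η : ℝ), 0 ≤ ξ → ξ ≤ (α : ℝ) → 0 ≤ η → η ≤ (β : ℝ) → (a ≠ ℓ → |fd a ξ η| ≤ C) ∧ (a ≠ ℓ' → |gd a ξ η| ≤ C) ∧ |dd a ξ η| ≤ C ∧ (∀ η' : ℝ, 0 ≤ η' → η' ≤ (β : ℝ) → |fd a ξ η - fd a ξ η'| ≤ C * |η - η'|) ∧ (∀ ξ' : ℝ, 0 ≤ ξ' → ξ' ≤ (α : ℝ) → |gd a ξ η - gd a ξ' η| ≤ C * |ξ - ξ'|)) ∧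
    (∀ k : ℕ, ∃ C : ℝ, ∀ (U : Fin k → Fin (m + 2)) (x : Fin k → ℝ) (ξ η : ℝ), (∀ i, 0 ≤ x i ∧ x i ≤ 1) → 0 ≤ ξ → ξ ≤ (α : ℝ) → 0 ≤ η → η ≤ (β : ℝ) → |Ht U x ξ η| ≤ C ∧ |dHt U x ξ η| ≤ C ∧ (0 < k → |Ht U x ξ η| ≤ C * ξ) ∧ (∀ η' : ℝ, 0 ≤ η' → η' ≤ (β : ℝ) → |Ht U x ξ η - Ht U x ξ η'| ≤ C * ξ * |η - η'|)) ∧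
    (∀ l : ℕ, ∃ C : ℝ, ∀ (V : Fin l → Fin (m + 2)) (y : Fin l → ℝ) (ξ η : ℝ), (∀ i, 0 ≤ y i ∧ y i ≤ 1) → 0 ≤ ξ → ξ ≤ (α : ℝ) → 0 ≤ η → η ≤ (β : ℝ) → |Vt V y ξ η| ≤ C ∧ |dVt V y ξ η| ≤ C ∧ (0 < l → |Vt V y ξ η| ≤ C * η) ∧ (∀ ξ' : ℝ, 0 ≤ ξ' → ξ' ≤ (α : ℝ) → |Vt V y ξ η - Vt V y ξ' η| ≤ C * η * |ξ - ξ'|)))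

/-! ### Coordinate blocks of cube points -/

/-! ### Pointwise peeling identities (★A) -/

include H in
/-- Moving the insertion operator across a right factor: `μ(op_a(X) Y) = μ(op_a(X Y))` up to the
commutator term `−[a = ℓ] μ(X [Z_ℓ, Y])`. [folklore] -/
theorem op_mul_right (μ : (DrinfeldKohnoTrunc ℚ (Fin 4) N) →ₗ[ℚ] ℚ) (a : Fin (m + 2))
    (X Y : DrinfeldKohnoTrunc ℚ (Fin 4) N) :
    (μ (op a X * Y) : ℝ) = (μ (op a (X * Y)) : ℝ) -
      (if a = ℓ then (μ (X * (Zq ℓ * Y - Y * Zq ℓ) * 1) : ℝ) else 0) := by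
  obtain ⟨_, hop, -⟩ := H
  by_cases ha : a = ℓ
  · subst ha
    rw [if_pos rfl, hop, hop, if_pos rfl, if_pos rfl, ← Rat.cast_sub, ← map_sub]
    congr 2; noncomm_ring
  · rw [if_neg ha, hop, hop, if_neg ha, if_neg ha, sub_zero, mul_assoc]

include H in
/-- **Resummation of the peeled coefficient**: with `c_ℓ = 1/s`, the peeling identity's right-hand
side is the sum over letters of `c_a Σ_{U'} ν(op_a(wZ U')) g(U')`. [folklore] -/
theorem peel_resum (ν : (DrinfeldKohnoTrunc ℚ (Fin 4) N) →ₗ[ℚ] ℚ) {k : ℕ} (g : (Fin k → Fin (m + 2)) → ℝ)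
    (c : Fin (m + 2) → ℝ) (s : ℝ) (hc : c ℓ = 1 / s) :
    ∑ a : Fin (m + 2), c a * ∑ U' : Fin k → Fin (m + 2), (ν (op a (wZ U')) : ℝ) * g U' =
      (∑ a : Fin (m + 2), c a * ∑ U' : Fin k → Fin (m + 2), (ν (Zq a * wZ U') : ℝ) * g U') -
        (1 / s) * ∑ U' : Fin k → Fin (m + 2), (ν (wZ U' * Zq ℓ) : ℝ) * g U' := by
  obtain ⟨_, hop, -⟩ := H
  have key : ∀ a : Fin (m + 2), c a * ∑ U' : Fin k → Fin (m + 2), (ν (op a (wZ U')) : ℝ) * g U' =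
      c a * ∑ U' : Fin k → Fin (m + 2), (ν (Zq a * wZ U') : ℝ) * g U' -
        (if a = ℓ then (1 / s) * ∑ U' : Fin k → Fin (m + 2), (ν (wZ U' * Zq ℓ) : ℝ) * g U' else 0) := by
    intro a
    by_cases ha : a = ℓ
    · subst ha
      rw [if_pos rfl, ← hc, ← mul_sub, ← Finset.sum_sub_distrib]
      congr 1
      refine Finset.sum_congr rfl fun U' _ => ?_
      rw [hop, if_pos rfl, map_sub, Rat.cast_sub, sub_mul]
    · rw [if_neg ha, sub_zero]
      congr 1
      refine Finset.sum_congr rfl fun U' _ => ?_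
      rw [hop, if_neg ha]
  rw [Finset.sum_congr rfl fun a _ => key a, Finset.sum_sub_distrib, Finset.sum_ite_eq']
  simp only [Finset.mem_univ, if_true]

include H in
/-- **Peeling the outermost letter, insertion-operator form** (pure algebra, any height `η`; `ξ, s ≠ 0`):
`Σ_U μ(wZ U · wZ V) Ht U (s :: x') ξ η = Σ_a ξ fd_a(ξ s, η) Σ_{U'} μ(op_a(wZ U') · wZ V) Ht U' x' (ξ s) η`.
[cite: IharaKanekoZagier2006, Cor. 5] -/
theorem peel_op (μ : (DrinfeldKohnoTrunc ℚ (Fin 4) N) →ₗ[ℚ] ℚ) {k : ℕ} (s : ℝ) (x' : Fin k → ℝ) (ξ η : ℝ)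
    (hξ : ξ ≠ 0) (hs : s ≠ 0) {l : ℕ} (V : Fin l → Fin (m + 2)) :
    ∑ U : Fin (k + 1) → Fin (m + 2), (μ (wZ U * wZ V) : ℝ) * Ht U (Fin.cons s x') ξ η =
      ∑ a : Fin (m + 2), (ξ * fd a (ξ * s) η) *
        ∑ U' : Fin k → Fin (m + 2), (μ (op a (wZ U') * wZ V) : ℝ) * Ht U' x' (ξ * s) η := by
  have H' := H
  obtain ⟨_, _, _, _, _, _, _, _, _, _, _, _, _, _, _, _, _, hfd_reg, _, _, _, hpeel, -⟩ := H'
  -- the functional `X ↦ μ (X * wZ V)`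
  have h := hpeel (μ ∘ₗ LinearMap.mulRight ℚ (wZ V)) s x' ξ η
  simp only [LinearMap.comp_apply, LinearMap.mulRight_apply] at h
  rw [h]
  have hcoef : ∀ a : Fin (m + 2), (if a = ℓ then 1 / s else ξ * fd a (ξ * s) η) = ξ * fd a (ξ * s) η := by
    intro a
    split_ifs with ha
    · subst ha; rw [hfd_reg]; field_simp
    · rfl
  simp only [hcoef]
  have h2 := peel_resum H (μ ∘ₗ LinearMap.mulRight ℚ (wZ V)) (fun U' => Ht U' x' (ξ * s) η)
    (fun a => ξ * fd a (ξ * s) η) s (by rw [hfd_reg]; field_simp)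
  simp only [LinearMap.comp_apply, LinearMap.mulRight_apply] at h2
  rw [h2]

include H in
/-- **(★A) Peeling with centrality**: for `ξ ≠ 0`, `s ≠ 0`, `y` in the open cube and
`0 < η ≤ β`, `Af μ (s :: x') y ξ η = Σ_a ξ fd_a(ξ s, η) Af (μ ∘ op_a) x' y (ξ s) η`
(the commutator terms `μ(wZ U' [Z_ℓ, wZ V])` are killed by the centrality of `Z_ℓ` against the
vertical edge transport). [cite: Drinfeld1991, §2] -/
theorem starA (μ : (DrinfeldKohnoTrunc ℚ (Fin 4) N) →ₗ[ℚ] ℚ) {k l : ℕ} (s : ℝ) (x' : Fin k → ℝ)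
    (y : Fin l → ℝ) (ξ η : ℝ) (hξ : ξ ≠ 0) (hs : s ≠ 0) (hy : ∀ i, 0 < y i ∧ y i < 1) (hη : 0 < η)
    (hηβ : η ≤ (β : ℝ)) :
    Af μ (Fin.cons s x') y ξ η =
      ∑ a : Fin (m + 2), (ξ * fd a (ξ * s) η) * Af (μ ∘ₗ op a) x' y (ξ * s) η := by
  have H' := H
  obtain ⟨_, _, _, hAf, _, _, _, _, _, _, _, _, _, _, _, _, _, _, _, _, _, _, _, hcentV, -⟩ := H'
  rw [hAf, Finset.sum_comm]
  have step1 : ∀ V : Fin l → Fin (m + 2),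
      ∑ U : Fin (k + 1) → Fin (m + 2), (μ (wZ U * wZ V) : ℝ) * (Ht U (Fin.cons s x') ξ η * Vt V y 0 η) =
        ∑ a : Fin (m + 2), (ξ * fd a (ξ * s) η) *
          ∑ U' : Fin k → Fin (m + 2), (μ (op a (wZ U') * wZ V) : ℝ) * (Ht U' x' (ξ * s) η * Vt V y 0 η) := by
    intro V
    have h := peel_op H μ s x' ξ η hξ hs V
    calc ∑ U : Fin (k + 1) → Fin (m + 2), (μ (wZ U * wZ V) : ℝ) * (Ht U (Fin.cons s x') ξ η * Vt V y 0 η)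
        = (∑ U : Fin (k + 1) → Fin (m + 2), (μ (wZ U * wZ V) : ℝ) * Ht U (Fin.cons s x') ξ η) * Vt V y 0 η := by
          rw [Finset.sum_mul]
          exact Finset.sum_congr rfl fun U _ => by ring
      _ = _ := by
          rw [h, Finset.sum_mul]
          refine Finset.sum_congr rfl fun a _ => ?_
          rw [mul_assoc, Finset.sum_mul]
          congr 1
          exact Finset.sum_congr rfl fun U' _ => by ring
  rw [Finset.sum_congr rfl fun V _ => step1 V, Finset.sum_comm]
  refine Finset.sum_congr rfl fun a _ => ?_
  rw [← Finset.mul_sum, hAf]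
  congr 1
  rw [Finset.sum_comm]
  refine Finset.sum_congr rfl fun U' _ => ?_
  simp only [LinearMap.comp_apply]
  by_cases ha : a = ℓ
  · rw [← sub_eq_zero, ← Finset.sum_sub_distrib]
    have hc := hcentV μ (wZ U') 1 y η hy hη hηβ
    calc ∑ V : Fin l → Fin (m + 2), ((μ (op a (wZ U') * wZ V) : ℝ) * (Ht U' x' (ξ * s) η * Vt V y 0 η) -
          (μ (op a (wZ U' * wZ V)) : ℝ) * (Ht U' x' (ξ * s) η * Vt V y 0 η))
        = ∑ V : Fin l → Fin (m + 2), -(Ht U' x' (ξ * s) η) *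
            ((μ (wZ U' * (Zq ℓ * wZ V - wZ V * Zq ℓ) * 1) : ℝ) * Vt V y 0 η) := by
          refine Finset.sum_congr rfl fun V _ => ?_
          rw [op_mul_right H μ a (wZ U') (wZ V), if_pos ha]; ring
      _ = 0 := by rw [← Finset.mul_sum, hc, mul_zero]
  · refine Finset.sum_congr rfl fun V _ => ?_
    rw [op_mul_right H μ a (wZ U') (wZ V), if_neg ha, sub_zero]

include H in
/-- **(★A) at height `0`** (no centrality needed): `Af μ (s :: x') y ξ 0 = Σ_a ξ fd_a(ξ s, 0) Bf (μ ∘ op_a) x' y (ξ s) 0`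
for `ξ, s ≠ 0` and any `y` (for `l ≥ 1` both sides vanish; for `l = 0` this is `peel_op`).
[cite: IharaKanekoZagier2006, Cor. 5] -/
theorem starA_zero (μ : (DrinfeldKohnoTrunc ℚ (Fin 4) N) →ₗ[ℚ] ℚ) {k l : ℕ} (s : ℝ) (x' : Fin k → ℝ)
    (y : Fin l → ℝ) (ξ : ℝ) (hξ : ξ ≠ 0) (hs : s ≠ 0) :
    Af μ (Fin.cons s x') y ξ 0 =
      ∑ a : Fin (m + 2), (ξ * fd a (ξ * s) 0) * Bf (μ ∘ₗ op a) x' y (ξ * s) 0 := by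
  have H' := H
  obtain ⟨_, _, _, hAf, hBf, _, _, _, _, _, _, _, hVt_nil, _, _, _, hVt_zero, -⟩ := H'
  cases l with
  | succ l' =>
    rw [hAf]
    simp_rw [hBf, hVt_zero, zero_mul, mul_zero, Finset.sum_const_zero, mul_zero, Finset.sum_const_zero]
  | zero =>
    rw [hAf]
    simp_rw [hBf, LinearMap.comp_apply, hVt_nil, one_mul, mul_one, Fintype.sum_unique, qe_wZ_nil H, one_mul, mul_one]
    have h := peel_op H μ s x' ξ 0 hξ hs (default : Fin 0 → Fin (m + 2))
    simp_rw [qe_wZ_nil H, mul_one] at h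
    exact h

/-! ### Step A.1 — peeling the outermost variable and splitting off the induction hypothesis

For `k' = k + 1`, `l`, parameters `e`, data `(Ξ, Η, σ)` (normalised: `σ = 0` where `Ξ Η = 0`):
the class of `σ 𝔄 = σ [A(Ξ,Η) − A(Ξ,0)]` on `[0,1]^{(k+1)+l+e}` equals, after moving `x₀` to the
new last parameter `s` (`Ξ₁ = Ξ s`), the sum over letters `a` of the classes of
`σ_a F^{μ∘op a}(Ξ₁, Η)` (an instance of uniform nullity in degree `k + l`, weight
`σ_a = σ Ξ fd_a(Ξ₁, Η)`) and of `σ Ξ [fd_a(Ξ₁,Η) B^{μ∘op a}(Ξ₁,Η) − fd_a(Ξ₁,0) B^{μ∘op a}(Ξ₁,0)]`. -/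

include H in
/-- **Step A.1 (peel and split).** [cite: Drinfeld1991, §2] -/
theorem stepA_split (μ : (DrinfeldKohnoTrunc ℚ (Fin 4) N) →ₗ[ℚ] ℚ) (k l e : ℕ) (Ξ Η σ : (Fin e → ℝ) → ℝ)
    (hΞΗ : ∀ θ ∈ KZ.cube e, 0 ≤ Ξ θ ∧ Ξ θ ≤ (α : ℝ) ∧ 0 ≤ Η θ ∧ Η θ ≤ (β : ℝ))
    (hσ0 : ∀ θ ∈ KZ.cube e, Ξ θ = 0 ∨ Η θ = 0 → σ θ = 0)
    (Ξ₁ Η₁ ρ : (Fin (e + 1) → ℝ) → ℝ) (σw : Fin (m + 2) → (Fin (e + 1) → ℝ) → ℝ)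
    (hΞ₁ : ∀ θ', Ξ₁ θ' = Ξ (Fin.init θ') * θ' (Fin.last e)) (hΗ₁ : ∀ θ', Η₁ θ' = Η (Fin.init θ'))
    (hρ : ∀ θ', ρ θ' = σ (Fin.init θ') * Ξ (Fin.init θ'))
    (hσw : ∀ a θ', σw a θ' = ρ θ' * fd a (Ξ₁ θ') (Η₁ θ'))
    (RA : KZ.IntegralRep (k + 1 + l + e)) (hRAd : RA.domain = KZ.cube (k + 1 + l + e))
    (hRAi : RA.integrand = fun z => σ (Θb (k + 1) l e z) *
      (Af μ (Xb (k + 1) l e z) (Yb (k + 1) l e z) (Ξ (Θb (k + 1) l e z)) (Η (Θb (k + 1) l e z)) -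
        Af μ (Xb (k + 1) l e z) (Yb (k + 1) l e z) (Ξ (Θb (k + 1) l e z)) 0))
    (P Q : Fin (m + 2) → KZ.IntegralRep (k + l + (e + 1)))
    (hPd : ∀ a, (P a).domain = KZ.cube (k + l + (e + 1)))
    (hQd : ∀ a, (Q a).domain = KZ.cube (k + l + (e + 1)))
    (hPi : ∀ a, (P a).integrand = fun w => σw a (Θb k l (e + 1) w) *
      F (μ ∘ₗ op a) (Xb k l (e + 1) w) (Yb k l (e + 1) w) (Ξ₁ (Θb k l (e + 1) w)) (Η₁ (Θb k l (e + 1) w)))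
    (hQi : ∀ a, (Q a).integrand = fun w => ρ (Θb k l (e + 1) w) *
      (fd a (Ξ₁ (Θb k l (e + 1) w)) (Η₁ (Θb k l (e + 1) w)) *
          Bf (μ ∘ₗ op a) (Xb k l (e + 1) w) (Yb k l (e + 1) w) (Ξ₁ (Θb k l (e + 1) w)) (Η₁ (Θb k l (e + 1) w)) -
        fd a (Ξ₁ (Θb k l (e + 1) w)) 0 *
          Bf (μ ∘ₗ op a) (Xb k l (e + 1) w) (Yb k l (e + 1) w) (Ξ₁ (Θb k l (e + 1) w)) 0)) :
    KZ.toPeriodAlgebra (KZ.toFormalPeriod (KZ.of RA)) =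
      ∑ a : Fin (m + 2), (KZ.toPeriodAlgebra (KZ.toFormalPeriod (KZ.of (P a))) +
        KZ.toPeriodAlgebra (KZ.toFormalPeriod (KZ.of (Q a)))) := by
  have H' := H
  obtain ⟨_, _, _, _, _, _, _, hF, hXb, hYb, hΘb, -⟩ := H'
  -- move `x₀` to the last slot
  have hh : k + 1 + l + e = k + l + e + 1 := by omega
  set ε : Fin (k + 1 + l + e) ≃ Fin (k + l + e + 1) := (finCongr hh).trans (finRotate (k + l + e + 1)).symm with hε
  have hcls : KZ.toPeriodAlgebra (KZ.toFormalPeriod (KZ.of RA)) =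
      KZ.toPeriodAlgebra (KZ.toFormalPeriod (KZ.of (RA.reindex ε))) := (CornerReps.cls_reindex RA ε).symm
  rw [hcls]
  -- finite integrand additivity over letters × {P, Q}, off the null boundary
  have hsum := CornerCubes.cls_finset_sum_open (ι := Fin (m + 2) × Bool) Finset.univ (RA.reindex ε)
    (fun p => if p.2 then P p.1 else Q p.1) (CornerReps.reindex_domain_cube RA ε hRAd)
    (fun p _ => by rcases p with ⟨a, _ | _⟩ <;> first | exact hQd a | exact hPd a) ?_
  · rw [hsum, Fintype.sum_prod_type]
    refine Finset.sum_congr rfl fun a _ => ?_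
    rw [Fintype.sum_bool]; simp only [ite_true, Bool.false_eq_true, ite_false]
  -- the pointwise identity on the open cube
  intro w hw
  rw [Fintype.sum_prod_type]
  simp only [Fintype.sum_bool, ite_true, Bool.false_eq_true, ite_false]
  rw [CornerReps.reindex_integrand, hRAi]
  simp only [hPi, hQi]
  -- the blocks of `w ∘ ε`
  obtain ⟨hb1, hb2, hb3⟩ := CornerBlocks.rot_blocks (k := k) (l := l) (e := e) hh w
  have hX : Xb (k + 1) l e (fun i => w (ε i)) = Fin.cons (w (Fin.natAdd (k + l) (Fin.last e))) (Xb k l (e + 1) w) := by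
    rw [hXb, hXb]; exact hb1
  have hY : Yb (k + 1) l e (fun i => w (ε i)) = Yb k l (e + 1) w := by
    rw [hYb, hYb]; exact hb2
  have hΘ : Θb (k + 1) l e (fun i => w (ε i)) = Fin.init (Θb k l (e + 1) w) := by
    rw [hΘb, hΘb]; exact hb3
  rw [hX, hY, hΘ]
  set Θ' := Θb k l (e + 1) w with hΘ'
  have hlast : w (Fin.natAdd (k + l) (Fin.last e)) = Θ' (Fin.last e) := by rw [hΘ', hΘb]
  rw [hlast]
  simp only [hσw, hρ, hΞ₁, hΗ₁, hF]
  -- the point data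
  obtain ⟨-, hyo, hΘo⟩ := CornerEngineEuler.blocks_open (k := k) (l := l) (e := e + 1) H hw
  have hΘc : Θ' ∈ KZ.cube (e + 1) := CornerCubes.openUnitCube_subset_cube hΘo
  have hθ : Fin.init Θ' ∈ KZ.cube e := KZ.mem_cube.2 fun s => (KZ.mem_cube.1 hΘc) _
  have hs0 : Θ' (Fin.last e) ≠ 0 := (hΘo (Fin.last e)).1.ne'
  by_cases hσ : σ (Fin.init Θ') = 0
  · simp only [hσ, zero_mul, add_zero, Finset.sum_const_zero]
  have hΞ0 : Ξ (Fin.init Θ') ≠ 0 := fun h => hσ (hσ0 _ hθ (Or.inl h))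
  have hΗ0 : Η (Fin.init Θ') ≠ 0 := fun h => hσ (hσ0 _ hθ (Or.inr h))
  obtain ⟨_, _, hΗge, hΗle⟩ := hΞΗ _ hθ
  have hΗpos : 0 < Η (Fin.init Θ') := lt_of_le_of_ne hΗge (Ne.symm hΗ0)
  rw [starA H μ _ _ _ _ _ hΞ0 hs0 hyo hΗpos hΗle, starA_zero H μ _ _ _ _ hΞ0 hs0, ← Finset.sum_sub_distrib,
    Finset.mul_sum]
  refine Finset.sum_congr rfl fun a _ => ?_
  ring

end AbstractEngine

/-- **Hook `cornerEngineSplit_coef`**: the regularised letter's peeling coefficient is the common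
form `ξ · (1/(ξ s)) = 1/s`. [folklore] -/
theorem cornerEngineSplit_coef : ∀ (ξ s : ℝ), ξ ≠ 0 → s ≠ 0 → ξ * (1 / (ξ * s)) = 1 / s :=
  fun ξ s hξ hs => by field_simp

end Summit.KontsevichZagierPeriods.FurushoPentagon.PentagonInKZ
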